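import Summits.Ventures.HSemireg.WedgeHankelRankProfileTrapezoid
import Summits.Ventures.HSemireg.WedgeHankelConfluentRank
import Mathlib.RingTheory.Polynomial.DegreeLT

/-!
# Venture HSemireg — THE RECURRENCE MODULE OF A CLASS: the linear recurrences of `q_0, …, q_N` of each window, read as polynomials, form the spaces
# `Rec_0(q) ⊆ Rec_1(q) ⊆ …` with **`dim Rec_k(q) = k + 1 − min(k + 1, N + 1 − k, R(q))`**; there is NO recurrence of window `≤ R(q)`, the minimal one `m` (window `R(q) + 1`) is
# UNIQUE up to a scalar when `2R(q) ≤ N + 1`, and **inside the window `R(q) ≤ k ≤ N + 1 − R(q)` every recurrence is a polynomial multiple of it: `Rec_k(q) = m · K[X]_{≤ k − R(q)}`**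
# (Berlekamp–Massey uniqueness; the window is exact); products of minimal recurrences kill sums, `R(q + q′) ≤ R(q) + R(q′)`

HONEST FRAMING. Part of the Lean index of the computation cell `pub-hsemireg` (seat p10 gen 26, Sunday typer «UNIFORM-IN-n»).
LINEAR ALGEBRA OF HANKEL (catalecticant) MATRICES and of polynomials over a field ONLY: no variety, no cohomology theory, no sheaf, no Ext group and no semiregularity map is constructed
here; nothing here says that HC / HC_CM / HC_AV holds; no Literature fact is declared or used.  Custodian versions as in `WedgeHankelSiegelIdeal` (1/3); the dictionary (`rank H_k(q)` = the
Hankel factor of THEOREM H; `R(q) = rank H_{⌊N/2⌋}(q)` the one integer per class of N15/N16/N17; a recurrence `Σ_{i ≤ k} p_i q_{i+s} = 0` = a left-kernel vector of `H_k(q)`) is QUOTED,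
never asserted.

WHAT IS IN THE TREE / KEYED.  N15 (`WedgeHankelRankProfileTrapezoid`, tree) THE TRAPEZOID LAW `rank_hankel1_eq_min` (`k ≤ N`: `rank H_k(q) = min(min(k+1, N+1−k), R(q))`); E6
(`WedgeHankelConfluentRank`, tree) `rank_hankel1_eq_zero_of_lt`; N17 (`WedgeHankelRankProfileRecurrence`, keyed № 156) reads `R(q) ≤ r` as the EXISTENCE of a recurrence of window `r + 1`
on coefficient vectors `a : Fin (r+1) → K`.  Mathlib: `Polynomial.degreeLT`, `Polynomial.degreeLTEquiv` (coefficient vectors), `Polynomial.lsum`, `Matrix.rank_transpose`,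
`Matrix.mulVecLin_transpose`, `LinearMap.finrank_range_add_finrank_ker`, `Submodule.eq_of_le_of_finrank_eq`.
THIS FILE (namespace `Summit.Ventures.HSemireg.Wedge.HankelOuter` continued; PLAIN on tree files; 2 definitions `hkFun`, `recSpace`):
* §464 the HANKEL FUNCTIONAL `hkFun q s : K[X] →ₗ K`, `p ↦ ⟪p, q⟫_s := Σ_i p_i q_{i+s}` (`hkFun_apply`, `hkFun_monomial`, `hkFun_X_pow`, `hkFun_eq_sum_range`), THE SHIFT RULE
  **`hkFun_X_mul`** (`⟪X·p, q⟫_s = ⟪p, q⟫_{s+1}`), `hkFun_X_pow_mul`, linearity in the sequence (`hkFun_add_seq`, `hkFun_smul_seq`).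
* §465 the RECURRENCE SPACE `recSpace N q k = K[X]_{≤ k} ⊓ ⋂_{s+k ≤ N} ker ⟪·, q⟫_s` (`mem_recSpace_iff`, `recSpace_le_degreeLT`, `finiteDimensional_recSpace`, `mem_degreeLT_succ_iff`);
  the bridge to the catalecticant **`degreeLTEquiv_vecMul_hankel1`** (coefficient vector `ᵥ* H_k(q)` = the row `(⟪p, q⟫_t)_t`) and **`mem_recSpace_iff_vecMul_eq_zero`** (`Rec_k(q)` = the
  left kernel of `H_k(q)`); `finrank_polynomial_degreeLT`; RANK–NULLITY **`finrank_recSpace_add_rank`** (`dim Rec_k(q) + rank H_k(q) = k + 1`, every `k`), `finrank_recSpace_eq`, THE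
  RECURRENCE ROW **`finrank_recSpace_eq_sub_min`** (`k ≤ N`: `dim Rec_k(q) = k + 1 − min(min(k+1, N+1−k), R(q))`), `recSpace_eq_degreeLT_of_lt` (`k > N`: no condition).
* §466 `recSpace_le_succ`, `recSpace_mono`; **`X_mul_mem_recSpace_succ`** (`p ∈ Rec_k ⇒ X·p ∈ Rec_{k+1}`), `X_pow_mul_mem_recSpace_add`, **`mul_mem_recSpace_add`** (`deg g ≤ d`,
  `p ∈ Rec_k ⇒ g·p ∈ Rec_{k+d}`), `map_mulRight_degreeLT_le_recSpace` (`m · K[X]_{≤ d} ⊆ Rec_{r+d}`), `finrank_map_mulRight_degreeLT` (`dim m · K[X]_{< n} = n`, `m ≠ 0`).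
* §467 with `R(q) = r`: **`recSpace_eq_bot_of_lt`** (`k < r ⇒ Rec_k(q) = 0`: no shorter recurrence), **`finrank_recSpace_self`** (`2r ≤ N+1 ⇒ dim Rec_r(q) = 1`: THE MINIMAL RECURRENCE
  IS UNIQUE UP TO A SCALAR), `exists_recSpace_self_eq_span` (`Rec_r(q) = K·m`, `m ≠ 0`), `natDegree_le_of_mem_recSpace`; THE RECURRENCE MODULE THEOREM **`recSpace_eq_map_mulRight`**
  (`2r + d ≤ N + 1`, `m ≠ 0` in `Rec_r(q)` ⇒ `Rec_{r+d}(q) = m · K[X]_{≤ d}`), `mem_recSpace_iff_exists_mul`, **`dvd_of_mem_recSpace`** (`k + r ≤ N + 1`: EVERY recurrence of window `k + 1`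
  is a MULTIPLE of `m`), SHARPNESS `map_mulRight_degreeLT_lt_recSpace` (`r + d ≤ N`, `N + 2 ≤ 2r + d` ⇒ proper inclusion) and **`recSpace_eq_map_mulRight_iff`** (THE WINDOW IS EXACT:
  `Rec_{r+d}(q) = m · K[X]_{≤ d} ↔ 2r + d ≤ N + 1`, for `r + d ≤ N`).
* §468 sums: `recSpace_inf_le_recSpace_add` (common recurrences of `q`, `q′` are recurrences of `q + q′`), **`mul_mem_recSpace_add_seq`** (`m ∈ Rec_r(q)`, `m′ ∈ Rec_{r′}(q′) ⇒
  m·m′ ∈ Rec_{r+r′}(q + q′)`), `hankel1_add`, **`rank_hankel1_add_le`** (`rank H_k(q+q′) ≤ rank H_k(q) + rank H_k(q′)`), `rank_hankel1_half_add_le` (`R(q+q′) ≤ R(q) + R(q′)`),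
  `recSpace_smul_seq` (`c ≠ 0 ⇒ Rec_k(c·q) = Rec_k(q)`).
READING: N17 said that `R(q)` is the ORDER of the shortest recurrence; this file says the recurrences themselves are ONE object — the minimal polynomial `m` of the class and its multiples,
exactly as far as the window `k + R(q) ≤ N + 1` reaches (beyond it the `(k+1) × (N+1−k)` catalecticant is too short to see `m`, and `Rec_k` has dimension `2k − N > k + 1 − R`).  By M14/N5 the
kernel `Kr(univ, w_N(q), k)` carries exactly `col H_k(q) ⊆ K^{k+1}`, whose annihilator among coefficient vectors is `Rec_k(q)`; the census N16 counts its rows.  Nothing Ext-side.  New names only.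
-/

open Module Polynomial
open scoped Matrix Polynomial

namespace Summit.Ventures.HSemireg.Wedge.HankelOuter

open Summit.Ventures.HSemireg.Wedge Summit.Ventures.HSemireg.Wedge.Hankel

variable (K : Type*) [Field K] {N : ℕ}

/-! ## §464. The Hankel functional of a polynomial against a coefficient sequence -/

/-- THE HANKEL FUNCTIONAL `⟪p, q⟫_s := Σ_i p_i · q_{i+s}` of the polynomial `p = Σ_i p_i X^i` against the coefficient sequence `q`, at the shift `s`
(the `s`-th term of the sequence `p(σ) q`, `σ` the left shift; quoted: the recurrence operator `p(σ)` applied to `q`). -/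
noncomputable def hkFun (q : ℕ → K) (s : ℕ) : K[X] →ₗ[K] K :=
  Polynomial.lsum fun i => (LinearMap.id : K →ₗ[K] K).smulRight (q (i + s))

/-- `⟪p, q⟫_s = Σ_{i ∈ supp p} p_i q_{i+s}`. -/
theorem hkFun_apply (q : ℕ → K) (s : ℕ) (p : K[X]) : hkFun K q s p = p.sum fun i c => c * q (i + s) := by
  simp [hkFun, Polynomial.lsum_apply, smul_eq_mul]

/-- `⟪c X^i, q⟫_s = c · q_{i+s}`. -/
@[simp] theorem hkFun_monomial (q : ℕ → K) (s i : ℕ) (c : K) : hkFun K q s (monomial i c) = c * q (i + s) := by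
  rw [hkFun_apply, sum_monomial_index _ _ (by rw [zero_mul])]

/-- `⟪X^i, q⟫_s = q_{i+s}`. -/
@[simp] theorem hkFun_X_pow (q : ℕ → K) (s i : ℕ) : hkFun K q s (Polynomial.X ^ i) = q (i + s) := by
  rw [← monomial_one_right_eq_X_pow, hkFun_monomial, one_mul]

/-- `⟪p, q⟫_s = Σ_{i < n} p_i q_{i+s}` as soon as `deg p < n`. -/
theorem hkFun_eq_sum_range (q : ℕ → K) (s : ℕ) {p : K[X]} {n : ℕ} (hp : p.natDegree < n) :
    hkFun K q s p = ∑ i ∈ Finset.range n, p.coeff i * q (i + s) := by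
  rw [hkFun_apply, sum_over_range' p (fun i => by rw [zero_mul]) n hp]

/-- THE SHIFT RULE `⟪X · p, q⟫_s = ⟪p, q⟫_{s+1}`. -/
theorem hkFun_X_mul (q : ℕ → K) (s : ℕ) (p : K[X]) : hkFun K q s (Polynomial.X * p) = hkFun K q (s + 1) p := by
  induction p using Polynomial.induction_on' with
  | add p p' hp hp' => rw [mul_add, map_add, map_add, hp, hp']
  | monomial i c =>
    rw [X_mul_monomial, hkFun_monomial, hkFun_monomial, show i + 1 + s = i + (s + 1) by omega]

/-- `⟪X^t · p, q⟫_s = ⟪p, q⟫_{s+t}`. -/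
theorem hkFun_X_pow_mul (q : ℕ → K) (s t : ℕ) (p : K[X]) : hkFun K q s (Polynomial.X ^ t * p) = hkFun K q (s + t) p := by
  induction t generalizing s with
  | zero => rw [pow_zero, one_mul, add_zero]
  | succ t ih => rw [pow_succ', mul_assoc, hkFun_X_mul, ih, show s + 1 + t = s + (t + 1) by omega]

/-- the functional is additive in the sequence. -/
theorem hkFun_add_seq (q q' : ℕ → K) (s : ℕ) (p : K[X]) : hkFun K (q + q') s p = hkFun K q s p + hkFun K q' s p := by
  rw [hkFun_apply, hkFun_apply, hkFun_apply, ← Polynomial.sum_add]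
  exact Finset.sum_congr rfl fun i _ => by simp only [Pi.add_apply, mul_add]

/-- … and homogeneous in the sequence. -/
theorem hkFun_smul_seq (c : K) (q : ℕ → K) (s : ℕ) (p : K[X]) : hkFun K (c • q) s p = c * hkFun K q s p := by
  rw [hkFun_apply, hkFun_apply, Polynomial.sum_def, Polynomial.sum_def, Finset.mul_sum]
  exact Finset.sum_congr rfl fun i _ => by rw [Pi.smul_apply, smul_eq_mul]; ring

/-! ## §465. The recurrence space of a window = the left kernel of the catalecticant, read as polynomials -/

/-- THE RECURRENCE SPACE `Rec_k(q)` OF WINDOW `k + 1` on `[0, N]`: the polynomials `p` of degree `≤ k` with `⟪p, q⟫_s = 0` for every `s ≤ N − k` — the linear recurrences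
`Σ_{i ≤ k} p_i q_{i+s} = 0` (`s + k ≤ N`) satisfied by `q_0, …, q_N`; by `mem_recSpace_iff_vecMul_eq_zero` the left kernel of `H_k(q)` read as polynomials. -/
noncomputable def recSpace (N : ℕ) (q : ℕ → K) (k : ℕ) : Submodule K K[X] :=
  Polynomial.degreeLT K (k + 1) ⊓ ⨅ (s : ℕ) (_ : s + k ≤ N), LinearMap.ker (hkFun K q s)

/-- membership spelled out. -/
theorem mem_recSpace_iff {q : ℕ → K} {k : ℕ} {p : K[X]} :
    p ∈ recSpace K N q k ↔ p ∈ Polynomial.degreeLT K (k + 1) ∧ ∀ s : ℕ, s + k ≤ N → hkFun K q s p = 0 := by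
  simp only [recSpace, Submodule.mem_inf, Submodule.mem_iInf, LinearMap.mem_ker]

/-- `Rec_k(q) ⊆ K[X]_{≤ k}`. -/
theorem recSpace_le_degreeLT (q : ℕ → K) (k : ℕ) : recSpace K N q k ≤ Polynomial.degreeLT K (k + 1) := inf_le_left

/-- `Rec_k(q)` is finite-dimensional (inside `K[X]_{≤ k}`). -/
theorem finiteDimensional_recSpace (q : ℕ → K) (k : ℕ) : FiniteDimensional K (recSpace K N q k) :=
  Submodule.finiteDimensional_of_le (recSpace_le_degreeLT K q k)

/-- `p ∈ K[X]_{≤ k}` iff `natDegree p ≤ k`. -/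
theorem mem_degreeLT_succ_iff {k : ℕ} {p : K[X]} : p ∈ Polynomial.degreeLT K (k + 1) ↔ p.natDegree ≤ k := by
  rw [Polynomial.degreeLT_succ_eq_degreeLE, Polynomial.mem_degreeLE, Polynomial.natDegree_le_iff_degree_le]

/-- the coefficient vector of `p ∈ K[X]_{≤ k}` times `H_k(q)` is the row of Hankel functionals `(⟪p, q⟫_t)_{t ≤ N − k}`. -/
theorem degreeLTEquiv_vecMul_hankel1 {k : ℕ} (q : ℕ → K) (p : Polynomial.degreeLT K (k + 1)) :
    (Polynomial.degreeLTEquiv K (k + 1) p) ᵥ* hankel1 K N k q = fun t : Fin (N + 1 - k) => hkFun K q (t : ℕ) (p : K[X]) := by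
  funext t
  have hdeg : (p : K[X]).natDegree < k + 1 := Nat.lt_succ_of_le ((mem_degreeLT_succ_iff K).mp p.2)
  rw [hkFun_eq_sum_range K q t hdeg, ← Fin.sum_univ_eq_sum_range (fun i => (p : K[X]).coeff i * q (i + t)) (k + 1)]
  simp only [Matrix.vecMul, dotProduct, hankel1, Matrix.of_apply]
  rfl

/-- **`p ∈ Rec_k(q)` iff the coefficient vector of `p` lies in the left kernel of `H_k(q)`** (`p` of degree `≤ k`). -/
theorem mem_recSpace_iff_vecMul_eq_zero {k : ℕ} (q : ℕ → K) (p : Polynomial.degreeLT K (k + 1)) :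
    (p : K[X]) ∈ recSpace K N q k ↔ (Polynomial.degreeLTEquiv K (k + 1) p) ᵥ* hankel1 K N k q = 0 := by
  rw [mem_recSpace_iff, degreeLTEquiv_vecMul_hankel1]
  constructor
  · rintro ⟨-, h⟩
    funext t
    exact h t (by have := t.2; omega)
  · intro h
    exact ⟨p.2, fun s hs => congrFun h ⟨s, by omega⟩⟩

/-- `dim K[X]_{< n} = n`. -/
theorem finrank_polynomial_degreeLT (n : ℕ) : finrank K (Polynomial.degreeLT K n) = n := by
  rw [(Polynomial.degreeLTEquiv K n).finrank_eq, Module.finrank_fin_fun]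

/-- **RANK–NULLITY FOR THE LEFT KERNEL: `dim Rec_k(q) + rank H_k(q) = k + 1`** (every `k`, every `q`, every field). -/
theorem finrank_recSpace_add_rank (k : ℕ) (q : ℕ → K) : finrank K (recSpace K N q k) + (hankel1 K N k q).rank = k + 1 := by
  set e := Polynomial.degreeLTEquiv K (k + 1) with he
  set φ : Polynomial.degreeLT K (k + 1) →ₗ[K] (Fin (N + 1 - k) → K) := (hankel1 K N k q).vecMulLinear ∘ₗ e.toLinearMap with hφ
  have hker : LinearMap.ker φ = (recSpace K N q k).comap (Polynomial.degreeLT K (k + 1)).subtype := by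
    ext p
    rw [LinearMap.mem_ker, Submodule.mem_comap, Submodule.subtype_apply, mem_recSpace_iff_vecMul_eq_zero]
    rfl
  have hrange : LinearMap.range φ = LinearMap.range (hankel1 K N k q).vecMulLinear :=
    LinearMap.range_comp_of_range_eq_top _ e.range
  have h1 := LinearMap.finrank_range_add_finrank_ker φ
  rw [hrange, hker, ← Matrix.mulVecLin_transpose, (Submodule.comapSubtypeEquivOfLe (recSpace_le_degreeLT K q k)).finrank_eq,
    finrank_polynomial_degreeLT] at h1
  rw [← Matrix.rank_transpose, Matrix.rank]
  omega

/-- `dim Rec_k(q) = k + 1 − rank H_k(q)`. -/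
theorem finrank_recSpace_eq (k : ℕ) (q : ℕ → K) : finrank K (recSpace K N q k) = k + 1 - (hankel1 K N k q).rank := by
  have := finrank_recSpace_add_rank K (N := N) k q
  omega

/-- **THE RECURRENCE ROW: `dim Rec_k(q) = k + 1 − min(k + 1, N + 1 − k, R(q))`** for every `k ≤ N` (the trapezoid law N15 read on the left kernel). -/
theorem finrank_recSpace_eq_sub_min {k : ℕ} (hk : k ≤ N) (q : ℕ → K) :
    finrank K (recSpace K N q k) = k + 1 - min (min (k + 1) (N + 1 - k)) ((hankel1 K N (N / 2) q).rank) := by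
  rw [finrank_recSpace_eq, rank_hankel1_eq_min K hk]

/-- beyond the top degree there is no constraint: `Rec_k(q) = K[X]_{≤ k}` for `k > N`. -/
theorem recSpace_eq_degreeLT_of_lt {k : ℕ} (hk : N < k) (q : ℕ → K) : recSpace K N q k = Polynomial.degreeLT K (k + 1) := by
  refine le_antisymm (recSpace_le_degreeLT K q k) fun p hp => (mem_recSpace_iff K).mpr ⟨hp, fun s hs => ?_⟩
  omega

/-! ## §466. Longer windows: `Rec_k ⊆ Rec_{k+1}`, `X · Rec_k ⊆ Rec_{k+1}` — the multiples of a recurrence are recurrences -/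

/-- `Rec_k(q) ⊆ Rec_{k+1}(q)` (a longer window imposes fewer conditions). -/
theorem recSpace_le_succ (q : ℕ → K) (k : ℕ) : recSpace K N q k ≤ recSpace K N q (k + 1) := by
  intro p hp
  rw [mem_recSpace_iff] at hp ⊢
  exact ⟨Polynomial.degreeLT_mono (by omega) hp.1, fun s hs => hp.2 s (by omega)⟩

/-- `Rec_k(q) ⊆ Rec_j(q)` for `k ≤ j`. -/
theorem recSpace_mono (q : ℕ → K) {k j : ℕ} (hkj : k ≤ j) : recSpace K N q k ≤ recSpace K N q j := by
  induction hkj with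
  | refl => exact le_rfl
  | step _ ih => exact ih.trans (recSpace_le_succ K q _)

/-- **`p ∈ Rec_k(q) ⇒ X · p ∈ Rec_{k+1}(q)`** (the shift rule). -/
theorem X_mul_mem_recSpace_succ {q : ℕ → K} {k : ℕ} {p : K[X]} (hp : p ∈ recSpace K N q k) : Polynomial.X * p ∈ recSpace K N q (k + 1) := by
  rw [mem_recSpace_iff] at hp ⊢
  refine ⟨?_, fun s hs => ?_⟩
  · rw [mem_degreeLT_succ_iff] at hp ⊢
    exact (Polynomial.natDegree_mul_le).trans (by have := Polynomial.natDegree_X_le (R := K); omega)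
  · rw [hkFun_X_mul]
    exact hp.2 (s + 1) (by omega)

/-- `p ∈ Rec_k(q) ⇒ X^t · p ∈ Rec_{k+t}(q)`. -/
theorem X_pow_mul_mem_recSpace_add {q : ℕ → K} {k : ℕ} {p : K[X]} (t : ℕ) (hp : p ∈ recSpace K N q k) :
    Polynomial.X ^ t * p ∈ recSpace K N q (k + t) := by
  induction t with
  | zero => rwa [pow_zero, one_mul, add_zero]
  | succ t ih =>
    rw [pow_succ', mul_assoc, ← add_assoc]
    exact X_mul_mem_recSpace_succ K ih

/-- **THE MULTIPLES OF A RECURRENCE ARE RECURRENCES: `p ∈ Rec_k(q)`, `deg g ≤ d ⇒ g · p ∈ Rec_{k+d}(q)`.** -/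
theorem mul_mem_recSpace_add {q : ℕ → K} {k d : ℕ} {p g : K[X]} (hg : g ∈ Polynomial.degreeLT K (d + 1)) (hp : p ∈ recSpace K N q k) :
    g * p ∈ recSpace K N q (k + d) := by
  have hdeg : g.natDegree < d + 1 := Nat.lt_succ_of_le ((mem_degreeLT_succ_iff K).mp hg)
  rw [Polynomial.as_sum_range' g (d + 1) hdeg, Finset.sum_mul]
  refine Submodule.sum_mem _ fun i hi => ?_
  rw [← Polynomial.C_mul_X_pow_eq_monomial, mul_assoc, Polynomial.C_mul']
  exact Submodule.smul_mem _ _ (recSpace_mono K q (by have := Finset.mem_range.mp hi; omega) (X_pow_mul_mem_recSpace_add K i hp))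

/-- hence `m · K[X]_{≤ d} ⊆ Rec_{r+d}(q)` for `m ∈ Rec_r(q)`. -/
theorem map_mulRight_degreeLT_le_recSpace {q : ℕ → K} {r : ℕ} {m : K[X]} (hm : m ∈ recSpace K N q r) (d : ℕ) :
    (Polynomial.degreeLT K (d + 1)).map (LinearMap.mulRight K m) ≤ recSpace K N q (r + d) := by
  rintro _ ⟨g, hg, rfl⟩
  rw [LinearMap.mulRight_apply]
  exact mul_mem_recSpace_add K hg hm

/-- `dim (m · K[X]_{< n}) = n` for `m ≠ 0`. -/
theorem finrank_map_mulRight_degreeLT {m : K[X]} (hm0 : m ≠ 0) (n : ℕ) :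
    finrank K ((Polynomial.degreeLT K n).map (LinearMap.mulRight K m)) = n := by
  rw [← (Submodule.equivMapOfInjective (LinearMap.mulRight K m) (mul_left_injective₀ hm0) _).finrank_eq, finrank_polynomial_degreeLT]

/-! ## §467. The minimal recurrence is unique and generates every recurrence inside the window (Berlekamp–Massey uniqueness) -/

/-- **NO RECURRENCE SHORTER THAN THE MIDDLE RANK: `Rec_k(q) = 0` for `k < R(q)`.** -/
theorem recSpace_eq_bot_of_lt {q : ℕ → K} {r k : ℕ} (hr : (hankel1 K N (N / 2) q).rank = r) (hk : k < r) : recSpace K N q k = ⊥ := by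
  have hrle : (hankel1 K N (N / 2) q).rank ≤ N / 2 + 1 := Matrix.rank_le_height _
  have h := finrank_recSpace_eq_sub_min K (show k ≤ N by omega) q
  rw [hr, min_eq_left (show k + 1 ≤ N + 1 - k by omega), min_eq_left (by omega : k + 1 ≤ r), Nat.sub_self] at h
  haveI := finiteDimensional_recSpace K (N := N) q k
  exact Submodule.finrank_eq_zero.mp h

/-- **THE MINIMAL RECURRENCE IS UNIQUE UP TO A SCALAR: `dim Rec_{R}(q) = 1`** whenever `2 R(q) ≤ N + 1`. -/
theorem finrank_recSpace_self {q : ℕ → K} {r : ℕ} (hr : (hankel1 K N (N / 2) q).rank = r) (h2r : r + r ≤ N + 1) :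
    finrank K (recSpace K N q r) = 1 := by
  have h := finrank_recSpace_eq_sub_min K (show r ≤ N by omega) q
  rw [hr] at h
  rw [h, min_eq_right (show r ≤ min (r + 1) (N + 1 - r) by rw [le_min_iff]; omega)]
  omega

/-- … so `Rec_R(q) = K · m` for some non-zero MINIMAL RECURRENCE `m` (`2 R(q) ≤ N + 1`). -/
theorem exists_recSpace_self_eq_span {q : ℕ → K} {r : ℕ} (hr : (hankel1 K N (N / 2) q).rank = r) (h2r : r + r ≤ N + 1) :
    ∃ m : K[X], m ≠ 0 ∧ recSpace K N q r = K ∙ m := by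
  have h1 := finrank_recSpace_self K hr h2r
  have hne : recSpace K N q r ≠ ⊥ := by
    intro h0; rw [h0, finrank_bot] at h1; exact zero_ne_one h1
  obtain ⟨m, hm, hm0⟩ := (Submodule.ne_bot_iff _).mp hne
  haveI := finiteDimensional_recSpace K (N := N) q r
  refine ⟨m, hm0, (Submodule.eq_of_le_of_finrank_eq ((Submodule.span_singleton_le_iff_mem m _).mpr hm) ?_).symm⟩
  rw [finrank_span_singleton hm0, h1]

/-- a minimal recurrence has degree `≤ R(q)`. -/
theorem natDegree_le_of_mem_recSpace {q : ℕ → K} {k : ℕ} {p : K[X]} (hp : p ∈ recSpace K N q k) : p.natDegree ≤ k :=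
  (mem_degreeLT_succ_iff K).mp (recSpace_le_degreeLT K q k hp)

/-- **THE RECURRENCE MODULE THEOREM (Berlekamp–Massey uniqueness inside the window): if `m ≠ 0` spans the minimal window `Rec_R(q)`, then for `2R + d ≤ N + 1` every recurrence of
window `R + d + 1` is a polynomial multiple `g · m` with `deg g ≤ d`: `Rec_{R+d}(q) = m · K[X]_{≤ d}`.** -/
theorem recSpace_eq_map_mulRight {q : ℕ → K} {r d : ℕ} (hr : (hankel1 K N (N / 2) q).rank = r) (hd : r + d + r ≤ N + 1) {m : K[X]}
    (hm : m ∈ recSpace K N q r) (hm0 : m ≠ 0) :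
    recSpace K N q (r + d) = (Polynomial.degreeLT K (d + 1)).map (LinearMap.mulRight K m) := by
  symm
  haveI := finiteDimensional_recSpace K (N := N) q (r + d)
  refine Submodule.eq_of_le_of_finrank_eq (map_mulRight_degreeLT_le_recSpace K hm d) ?_
  rw [finrank_map_mulRight_degreeLT K hm0]
  rcases Nat.lt_or_ge N (r + d) with hlt | hle
  · -- only possible for `r = 0`, `d = N + 1`
    rw [recSpace_eq_degreeLT_of_lt K hlt, finrank_polynomial_degreeLT]
    omega
  · rw [finrank_recSpace_eq_sub_min K hle q, hr, min_eq_right (show r ≤ min (r + d + 1) (N + 1 - (r + d)) by rw [le_min_iff]; omega)]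
    omega

/-- membership form: for `2R + d ≤ N + 1`, **`p ∈ Rec_{R+d}(q) ↔ p = g · m` with `deg g ≤ d`.** -/
theorem mem_recSpace_iff_exists_mul {q : ℕ → K} {r d : ℕ} (hr : (hankel1 K N (N / 2) q).rank = r) (hd : r + d + r ≤ N + 1) {m : K[X]}
    (hm : m ∈ recSpace K N q r) (hm0 : m ≠ 0) {p : K[X]} :
    p ∈ recSpace K N q (r + d) ↔ ∃ g ∈ Polynomial.degreeLT K (d + 1), g * m = p := by
  rw [recSpace_eq_map_mulRight K hr hd hm hm0]
  constructor
  · rintro ⟨g, hg, rfl⟩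
    exact ⟨g, hg, rfl⟩
  · rintro ⟨g, hg, rfl⟩
    exact ⟨g, hg, rfl⟩

/-- **EVERY LINEAR RECURRENCE OF `q_0, …, q_N` OF WINDOW `≤ N + 2 − R(q)` IS A MULTIPLE OF THE MINIMAL ONE: `p ∈ Rec_k(q)`, `k + R(q) ≤ N + 1 ⇒ m ∣ p`.** -/
theorem dvd_of_mem_recSpace {q : ℕ → K} {r k : ℕ} (hr : (hankel1 K N (N / 2) q).rank = r) (hk : k + r ≤ N + 1) {m : K[X]}
    (hm : m ∈ recSpace K N q r) (hm0 : m ≠ 0) {p : K[X]} (hp : p ∈ recSpace K N q k) : m ∣ p := by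
  rcases Nat.lt_or_ge k r with hlt | hle
  · rw [recSpace_eq_bot_of_lt K hr hlt, Submodule.mem_bot] at hp
    rw [hp]
    exact dvd_zero m
  · obtain ⟨d, rfl⟩ := Nat.exists_eq_add_of_le hle
    obtain ⟨g, -, rfl⟩ := (mem_recSpace_iff_exists_mul K hr (by omega) hm hm0).mp hp
    exact Dvd.intro_left g rfl

/-- **SHARPNESS: beyond the window the multiples are a PROPER subspace** — for `R + d ≤ N` with `N + 2 ≤ 2R + d`, `m · K[X]_{≤ d} < Rec_{R+d}(q)`. -/
theorem map_mulRight_degreeLT_lt_recSpace {q : ℕ → K} {r d : ℕ} (hr : (hankel1 K N (N / 2) q).rank = r) (hdN : r + d ≤ N)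
    (hd : N + 2 ≤ r + d + r) {m : K[X]} (hm : m ∈ recSpace K N q r) (hm0 : m ≠ 0) :
    (Polynomial.degreeLT K (d + 1)).map (LinearMap.mulRight K m) < recSpace K N q (r + d) := by
  refine lt_of_le_of_ne (map_mulRight_degreeLT_le_recSpace K hm d) fun heq => ?_
  have h : finrank K ((Polynomial.degreeLT K (d + 1)).map (LinearMap.mulRight K m)) = finrank K (recSpace K N q (r + d)) := by rw [heq]
  have hrle : (hankel1 K N (N / 2) q).rank ≤ N / 2 + 1 := Matrix.rank_le_height _
  rw [finrank_map_mulRight_degreeLT K hm0, finrank_recSpace_eq_sub_min K hdN q, hr,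
    min_eq_left (show min (r + d + 1) (N + 1 - (r + d)) ≤ r by rw [min_le_iff]; omega),
    min_eq_right (show N + 1 - (r + d) ≤ r + d + 1 by omega)] at h
  omega

/-- **THE WINDOW IS EXACT: for `R ≤ k = R + d ≤ N`, `Rec_k(q) = m · K[X]_{≤ d}` iff `k + R ≤ N + 1`.** -/
theorem recSpace_eq_map_mulRight_iff {q : ℕ → K} {r d : ℕ} (hr : (hankel1 K N (N / 2) q).rank = r) (hdN : r + d ≤ N) {m : K[X]}
    (hm : m ∈ recSpace K N q r) (hm0 : m ≠ 0) :
    recSpace K N q (r + d) = (Polynomial.degreeLT K (d + 1)).map (LinearMap.mulRight K m) ↔ r + d + r ≤ N + 1 := by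
  constructor
  · intro h
    by_contra hlt
    exact (map_mulRight_degreeLT_lt_recSpace K hr hdN (by omega) hm hm0).ne h.symm
  · intro h
    exact recSpace_eq_map_mulRight K hr h hm hm0

/-! ## §468. Sums of classes: the product of two minimal recurrences, sub-additivity of the middle rank -/

/-- a common recurrence of `q` and `q'` is a recurrence of `q + q'`. -/
theorem recSpace_inf_le_recSpace_add (q q' : ℕ → K) (k : ℕ) : recSpace K N q k ⊓ recSpace K N q' k ≤ recSpace K N (q + q') k := by
  intro p hp
  rw [Submodule.mem_inf, mem_recSpace_iff, mem_recSpace_iff] at hp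
  rw [mem_recSpace_iff]
  exact ⟨hp.1.1, fun s hs => by rw [hkFun_add_seq, hp.1.2 s hs, hp.2.2 s hs, add_zero]⟩

/-- **THE PRODUCT OF RECURRENCES: `m ∈ Rec_r(q)`, `m' ∈ Rec_{r'}(q') ⇒ m · m' ∈ Rec_{r+r'}(q + q')`.** -/
theorem mul_mem_recSpace_add_seq {q q' : ℕ → K} {r r' : ℕ} {m m' : K[X]} (hm : m ∈ recSpace K N q r) (hm' : m' ∈ recSpace K N q' r') :
    m * m' ∈ recSpace K N (q + q') (r + r') := by
  refine recSpace_inf_le_recSpace_add K q q' _ (Submodule.mem_inf.mpr ⟨?_, ?_⟩)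
  · rw [mul_comm]
    exact mul_mem_recSpace_add K (recSpace_le_degreeLT K q' r' hm') hm
  · rw [add_comm r]
    exact mul_mem_recSpace_add K (recSpace_le_degreeLT K q r hm) hm'

/-- the catalecticant is additive in the sequence. -/
theorem hankel1_add (k : ℕ) (q q' : ℕ → K) : hankel1 K N k (q + q') = hankel1 K N k q + hankel1 K N k q' := by
  ext i s; rfl

/-- **SUB-ADDITIVITY: `rank H_k(q + q') ≤ rank H_k(q) + rank H_k(q')`**, in particular for the middle rank `R(q + q') ≤ R(q) + R(q')`. -/
theorem rank_hankel1_add_le (k : ℕ) (q q' : ℕ → K) : (hankel1 K N k (q + q')).rank ≤ (hankel1 K N k q).rank + (hankel1 K N k q').rank := by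
  have h : LinearMap.range (hankel1 K N k (q + q')).mulVecLin ≤ LinearMap.range (hankel1 K N k q).mulVecLin ⊔ LinearMap.range (hankel1 K N k q').mulVecLin := by
    rintro _ ⟨v, rfl⟩
    rw [hankel1_add, Matrix.mulVecLin_add, LinearMap.add_apply]
    exact Submodule.add_mem_sup (LinearMap.mem_range_self _ _) (LinearMap.mem_range_self _ _)
  exact (Submodule.finrank_mono h).trans (Submodule.finrank_add_le_finrank_add_finrank _ _)

/-- `R(q + q') ≤ R(q) + R(q')`. -/
theorem rank_hankel1_half_add_le (q q' : ℕ → K) :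
    (hankel1 K N (N / 2) (q + q')).rank ≤ (hankel1 K N (N / 2) q).rank + (hankel1 K N (N / 2) q').rank :=
  rank_hankel1_add_le K (N / 2) q q'

/-- a non-zero scalar does not change the recurrences: `Rec_k(c · q) = Rec_k(q)`. -/
theorem recSpace_smul_seq {c : K} (hc : c ≠ 0) (q : ℕ → K) (k : ℕ) : recSpace K N (c • q) k = recSpace K N q k := by
  ext p
  simp only [mem_recSpace_iff, hkFun_smul_seq, mul_eq_zero, hc, false_or]

end Summit.Ventures.HSemireg.Wedge.HankelOuter
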